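import Literature.AlgebraicTopology.SingularHomology.StdSimplexFaces
import Mathlib.Topology.Order.Lattice
import HarnessLib

/-!
# Horns of the standard simplex are retracts; filling a horn by given faces

Topic `Literature/AlgebraicTopology/SingularHomology`. Elementary convex geometry of the standard
simplex `Δⁿ⁺¹ = Literature.AlgebraicTopology.SingularHomology.StdSimplex (n + 1)` (Mathlib's
`stdSimplex ℝ (Fin (n + 2))`), absent from Mathlib and needed by the Eilenberg-subcomplex proof of
the Hurewicz theorem (E. H. Spanier, *Algebraic Topology* (1981), Ch. 7 §5 (d): realising sums in
`πₙ(X, x₀)` by faces of singular `(n+1)`-simplices — "there exist maps satisfying (a) and (c) …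
(such maps exist by the homotopy extension property)", p. 392; and the Kan condition of the
singular complex, D. M. Kan, *A combinatorial definition of homotopy groups*, Ann. of Math. 67
(1958)). Everything is PROVED, `[folklore]`:

* `stdHorn j ⊆ Δⁿ⁺¹` — the `j`-th horn `Λⱼⁿ⁺¹`, union of the facets `δᵢ(Δⁿ)`, `i ≠ j` (points with
  a vanishing coordinate other than the `j`-th); closed, contained in the boundary;
* `hornMin j t = min_{i ≠ j} tᵢ` and the **retraction** `hornRetr j : C(Δⁿ⁺¹, Δⁿ⁺¹)` onto the horn,
  `t ↦ t - μ·𝟙_{≠ j} + (n+1) μ eⱼ`, `μ = hornMin j t` (projection along a direction transverse to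
  all facets but the `j`-th): `hornRetr_mem_stdHorn`, `hornRetr_eq_self` on the horn;
* `hornFill j g hg : C(Δⁿ⁺¹, X)` — **filling the horn**: given continuous `gᵢ : Δⁿ → X` for
  `i ≠ j`, each constant `= x₀` on `∂Δⁿ` (so that they agree on the pairwise intersections of the
  facets), the map `Δⁿ⁺¹ → X` which is `gᵢ ∘ (δᵢ)⁻¹` on the facet `δᵢ(Δⁿ)` for every `i ≠ j`
  (glued along the closed cover of the horn, then extended by the retraction):
  `hornFill_comp_stdFace : hornFill j g hg ∘ δᵢ = gᵢ` for `i ≠ j`; moreover `hornFill` takes the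
  value `x₀` wherever two coordinates vanish (`hornFill_apply_of_two_zero`), i.e. on the
  codimension-two skeleton.

## References

* E. H. Spanier, *Algebraic Topology*, Springer 1981, Ch. 7 §4 p. 392, §5 (d) p. 397. [Spanier1981]
* A. Hatcher, *Algebraic Topology*, CUP 2002, §2.1 (faces of `Δⁿ`). [HatcherAT2002]
-/

noncomputable section

open Set Function

universe u

namespace Literature.AlgebraicTopology.SingularHomology

variable {n : ℕ}

/-! ### The horn `Λⱼⁿ⁺¹` -/

/-- The **`j`-th horn** `Λⱼⁿ⁺¹ ⊆ Δⁿ⁺¹`: the union of all facets except the `j`-th, i.e. the points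
with some vanishing barycentric coordinate of index `≠ j`. [folklore] -/
def stdHorn (j : Fin (n + 2)) : Set (StdSimplex (n + 1)) :=
  {t | ∃ i, i ≠ j ∧ (t : Fin (n + 2) → ℝ) i = 0}

/-- Membership in the horn. [folklore] -/
lemma mem_stdHorn_iff (j : Fin (n + 2)) (t : StdSimplex (n + 1)) :
    t ∈ stdHorn j ↔ ∃ i, i ≠ j ∧ (t : Fin (n + 2) → ℝ) i = 0 := Iff.rfl

/-- The horn lies in the boundary. [folklore] -/
lemma stdHorn_subset_stdBoundary (j : Fin (n + 2)) : stdHorn j ⊆ stdBoundary (n + 1) :=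
  fun _ ⟨i, _, hi⟩ => ⟨i, hi⟩

/-- The facets `δᵢ(Δⁿ)`, `i ≠ j`, lie in the `j`-th horn. [folklore] -/
lemma stdFace_mem_stdHorn {i j : Fin (n + 2)} (h : i ≠ j) (z : StdSimplex n) : stdFace i z ∈ stdHorn j :=
  ⟨i, h, stdFace_apply_self i z⟩

/-- The horn is the union of the facets `δᵢ(Δⁿ)`, `i ≠ j`. [folklore] -/
lemma stdHorn_eq_iUnion (j : Fin (n + 2)) :
    stdHorn j = ⋃ i : {i : Fin (n + 2) // i ≠ j}, range (stdFace (n := n) i.1) := by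
  ext t
  simp only [mem_stdHorn_iff, mem_iUnion, mem_range]
  constructor
  · rintro ⟨i, hij, hi⟩
    obtain ⟨z, hz⟩ := exists_stdFace_eq i t hi
    exact ⟨⟨i, hij⟩, z, hz⟩
  · rintro ⟨⟨i, hij⟩, z, rfl⟩
    exact ⟨i, hij, stdFace_apply_self i z⟩

/-- The horn is closed. [folklore] -/
lemma isClosed_stdHorn (j : Fin (n + 2)) : IsClosed (stdHorn (n := n) j) := by
  rw [stdHorn_eq_iUnion]
  exact isClosed_iUnion_of_finite fun i => isClosed_range_stdFace i.1

/-! ### The retraction of the simplex onto a horn -/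

/-- The index set `{i | i ≠ j}` as a nonempty finset (there are `n + 1 ≥ 1` such indices).
[folklore] -/
lemma univ_erase_nonempty (j : Fin (n + 2)) : (Finset.univ.erase j).Nonempty := by
  rw [← Finset.card_pos, Finset.card_erase_of_mem (Finset.mem_univ j), Finset.card_univ,
    Fintype.card_fin]
  omega

/-- `μⱼ(t) = min_{i ≠ j} tᵢ`, the distance of `t` to the horn `Λⱼ` along the retraction
direction. [folklore] -/
def hornMin (j : Fin (n + 2)) (t : StdSimplex (n + 1)) : ℝ :=
  (Finset.univ.erase j).inf' (univ_erase_nonempty j) fun i => (t : Fin (n + 2) → ℝ) i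

/-- `μⱼ(t) ≤ tᵢ` for `i ≠ j`. [folklore] -/
lemma hornMin_le {j i : Fin (n + 2)} (h : i ≠ j) (t : StdSimplex (n + 1)) :
    hornMin j t ≤ (t : Fin (n + 2) → ℝ) i :=
  Finset.inf'_le _ (Finset.mem_erase.2 ⟨h, Finset.mem_univ i⟩)

/-- `0 ≤ μⱼ(t)`. [folklore] -/
lemma hornMin_nonneg (j : Fin (n + 2)) (t : StdSimplex (n + 1)) : 0 ≤ hornMin j t :=
  Finset.le_inf' _ _ fun i _ => t.2.1 i

/-- The minimum `μⱼ(t)` is attained at some index `i ≠ j`. [folklore] -/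
lemma exists_apply_eq_hornMin (j : Fin (n + 2)) (t : StdSimplex (n + 1)) :
    ∃ i, i ≠ j ∧ (t : Fin (n + 2) → ℝ) i = hornMin j t := by
  obtain ⟨i, hi, h⟩ := Finset.exists_mem_eq_inf' (univ_erase_nonempty j)
    (fun i => (t : Fin (n + 2) → ℝ) i)
  exact ⟨i, (Finset.mem_erase.1 hi).1, h.symm⟩

/-- `μⱼ(t) = 0` exactly on the horn `Λⱼ`. [folklore] -/
lemma hornMin_eq_zero_iff (j : Fin (n + 2)) (t : StdSimplex (n + 1)) :
    hornMin j t = 0 ↔ t ∈ stdHorn j := by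
  constructor
  · intro h
    obtain ⟨i, hij, hi⟩ := exists_apply_eq_hornMin j t
    exact ⟨i, hij, hi.trans h⟩
  · rintro ⟨i, hij, hi⟩
    exact le_antisymm (hi ▸ hornMin_le hij t) (hornMin_nonneg j t)

/-- `μⱼ` is continuous. [folklore] -/
lemma continuous_hornMin (j : Fin (n + 2)) : Continuous (hornMin (n := n) j) :=
  Continuous.finset_inf'_apply (univ_erase_nonempty j)
    fun i _ => (continuous_apply i).comp continuous_subtype_val

/-- The coordinates of the retraction `rⱼ(t)`: `tᵢ - μ` for `i ≠ j` and `tⱼ + (n+1) μ` for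
`i = j`. [folklore] -/
def hornRetrFun (j : Fin (n + 2)) (t : StdSimplex (n + 1)) : Fin (n + 2) → ℝ := fun i =>
  if i = j then (t : Fin (n + 2) → ℝ) i + ((n : ℝ) + 1) * hornMin j t
  else (t : Fin (n + 2) → ℝ) i - hornMin j t

/-- `rⱼ(t)` is again a point of the simplex. [folklore] -/
lemma hornRetrFun_mem (j : Fin (n + 2)) (t : StdSimplex (n + 1)) :
    hornRetrFun j t ∈ stdSimplex ℝ (Fin (n + 2)) := by
  refine ⟨fun i => ?_, ?_⟩
  · unfold hornRetrFun
    split_ifs with h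
    · exact add_nonneg (t.2.1 i) (mul_nonneg (by positivity) (hornMin_nonneg j t))
    · exact sub_nonneg.2 (hornMin_le h t)
  · have hsum : ∑ i, (t : Fin (n + 2) → ℝ) i = 1 := t.2.2
    have hsplit := Finset.sum_erase_add Finset.univ (hornRetrFun j t) (Finset.mem_univ j)
    rw [← hsplit]
    have h1 : ∑ i ∈ Finset.univ.erase j, hornRetrFun j t i =
        ∑ i ∈ Finset.univ.erase j, ((t : Fin (n + 2) → ℝ) i - hornMin j t) :=
      Finset.sum_congr rfl fun i hi => by rw [hornRetrFun, if_neg (Finset.mem_erase.1 hi).1]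
    have hcard : (Finset.univ.erase j).card = n + 1 := by
      rw [Finset.card_erase_of_mem (Finset.mem_univ j), Finset.card_univ, Fintype.card_fin]
      omega
    rw [h1, Finset.sum_sub_distrib, Finset.sum_const, hcard, hornRetrFun, if_pos rfl]
    have h2 := Finset.sum_erase_add Finset.univ (fun i => (t : Fin (n + 2) → ℝ) i) (Finset.mem_univ j)
    simp only [nsmul_eq_mul, Nat.cast_add, Nat.cast_one] at h2 ⊢
    linarith

/-- **The retraction `rⱼ : Δⁿ⁺¹ → Λⱼⁿ⁺¹` of the simplex onto its `j`-th horn** (continuous,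
piecewise affine). [folklore] -/
def hornRetr (j : Fin (n + 2)) : C(StdSimplex (n + 1), StdSimplex (n + 1)) where
  toFun t := ⟨hornRetrFun j t, hornRetrFun_mem j t⟩
  continuous_toFun := by
    refine Continuous.subtype_mk (continuous_pi fun i => ?_) _
    unfold hornRetrFun
    split_ifs
    · exact ((continuous_apply i).comp continuous_subtype_val).add
        (continuous_const.mul (continuous_hornMin j))
    · exact ((continuous_apply i).comp continuous_subtype_val).sub (continuous_hornMin j)

/-- Coordinates of `rⱼ(t)` off `j`. [folklore] -/
lemma hornRetr_apply_of_ne {j i : Fin (n + 2)} (h : i ≠ j) (t : StdSimplex (n + 1)) :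
    (hornRetr j t : Fin (n + 2) → ℝ) i = (t : Fin (n + 2) → ℝ) i - hornMin j t := by
  change hornRetrFun j t i = _
  rw [hornRetrFun, if_neg h]

/-- The `j`-th coordinate of `rⱼ(t)`. [folklore] -/
lemma hornRetr_apply_self (j : Fin (n + 2)) (t : StdSimplex (n + 1)) :
    (hornRetr j t : Fin (n + 2) → ℝ) j = (t : Fin (n + 2) → ℝ) j + ((n : ℝ) + 1) * hornMin j t := by
  change hornRetrFun j t j = _
  rw [hornRetrFun, if_pos rfl]

/-- **`rⱼ` lands in the horn**: the coordinate where the minimum is attained becomes `0`. [folklore] -/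
lemma hornRetr_mem_stdHorn (j : Fin (n + 2)) (t : StdSimplex (n + 1)) : hornRetr j t ∈ stdHorn j := by
  obtain ⟨i, hij, hi⟩ := exists_apply_eq_hornMin j t
  exact ⟨i, hij, by rw [hornRetr_apply_of_ne hij, hi, sub_self]⟩

/-- **`rⱼ` is the identity on the horn.** [folklore] -/
lemma hornRetr_eq_self {j : Fin (n + 2)} {t : StdSimplex (n + 1)} (ht : t ∈ stdHorn j) :
    hornRetr j t = t := by
  have h0 : hornMin j t = 0 := (hornMin_eq_zero_iff j t).2 ht
  ext i
  by_cases h : i = j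
  · subst h; rw [hornRetr_apply_self, h0, mul_zero, add_zero]
  · rw [hornRetr_apply_of_ne h, h0, sub_zero]

/-- `rⱼ ∘ δᵢ = δᵢ` for `i ≠ j`. [folklore] -/
lemma hornRetr_stdFace {i j : Fin (n + 2)} (h : i ≠ j) (z : StdSimplex n) :
    hornRetr j (stdFace i z) = stdFace i z :=
  hornRetr_eq_self (stdFace_mem_stdHorn h z)

/-- If `rⱼ(t)` has a vanishing coordinate `i ≠ j` and `t` has two vanishing coordinates … more
usefully: **a point with two vanishing coordinates is in every horn and fixed by every `rⱼ`**,
and every index `i ≠ j` with `tᵢ = 0` still has `(rⱼ t)ᵢ = 0`. [folklore] -/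
lemma hornRetr_apply_eq_zero {j i : Fin (n + 2)} (h : i ≠ j) {t : StdSimplex (n + 1)}
    (hi : (t : Fin (n + 2) → ℝ) i = 0) : (hornRetr j t : Fin (n + 2) → ℝ) i = 0 := by
  rw [hornRetr_eq_self ⟨i, h, hi⟩, hi]

/-! ### Filling a horn with prescribed faces -/

section Fill

variable {X : Type u} [TopologicalSpace X] {x₀ : X}

/-- Deleting the `i`-th coordinate of a point on the `i`-th facet which has another vanishing
coordinate gives a boundary point of `Δⁿ`. [folklore] -/
lemma faceRetr_mem_stdBoundary {i l : Fin (n + 2)} (hli : l ≠ i) {y : StdSimplex (n + 1)}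
    (hyi : (y : Fin (n + 2) → ℝ) i = 0) (hyl : (y : Fin (n + 2) → ℝ) l = 0) :
    faceRetr i y ∈ stdBoundary n := by
  obtain ⟨z, rfl⟩ := exists_stdFace_eq i y hyi
  rw [faceRetr_stdFace]
  obtain ⟨l', rfl⟩ := Fin.exists_succAbove_eq hli
  exact ⟨l', by rwa [stdFace_apply_succAbove] at hyl⟩

open Classical in
/-- An index `i ≠ j` with `yᵢ = 0`, if there is one (else `j`). [folklore] -/
def hornIdx (j : Fin (n + 2)) (y : StdSimplex (n + 1)) : Fin (n + 2) :=
  if h : ∃ i, i ≠ j ∧ (y : Fin (n + 2) → ℝ) i = 0 then h.choose else j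

/-- On the horn, `hornIdx j y ≠ j` and the corresponding coordinate vanishes. [folklore] -/
lemma hornIdx_spec {j : Fin (n + 2)} {y : StdSimplex (n + 1)} (hy : y ∈ stdHorn j) :
    hornIdx j y ≠ j ∧ (y : Fin (n + 2) → ℝ) (hornIdx j y) = 0 := by
  have h : ∃ i, i ≠ j ∧ (y : Fin (n + 2) → ℝ) i = 0 := hy
  rw [hornIdx, dif_pos h]
  exact h.choose_spec

/-- The glued map on `Δⁿ⁺¹` (meaningful on the horn): `y ↦ g_ι (faceRetr ι y)` with
`ι = hornIdx j y`. [folklore] -/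
def hornGlue (j : Fin (n + 2)) (g : Fin (n + 2) → C(StdSimplex n, X)) (y : StdSimplex (n + 1)) : X :=
  g (hornIdx j y) (faceRetr (hornIdx j y) y)

/-- On the facet `δᵢ(Δⁿ)`, `i ≠ j`, the glued map is `gᵢ ∘ faceRetr i`, provided all `g_l`, `l ≠ j`,
are constant `= x₀` on `∂Δⁿ` (two candidate indices give a boundary point for both). [folklore] -/
lemma hornGlue_eq_of_apply_eq_zero {j : Fin (n + 2)} {g : Fin (n + 2) → C(StdSimplex n, X)}
    (hg : ∀ l, l ≠ j → ∀ z ∈ stdBoundary n, g l z = x₀) {i : Fin (n + 2)} (hij : i ≠ j)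
    {y : StdSimplex (n + 1)} (hyi : (y : Fin (n + 2) → ℝ) i = 0) :
    hornGlue j g y = g i (faceRetr i y) := by
  obtain ⟨hιj, hι⟩ := hornIdx_spec (j := j) (y := y) ⟨i, hij, hyi⟩
  unfold hornGlue
  by_cases h : hornIdx j y = i
  · rw [h]
  · rw [hg _ hιj _ (faceRetr_mem_stdBoundary (Ne.symm h) hι hyi),
      hg _ hij _ (faceRetr_mem_stdBoundary h hyi hι)]

/-- The glued map is continuous on the horn (a finite closed cover by facets, on each of which it
is `gᵢ ∘ faceRetr i`). [folklore] -/
lemma continuousOn_hornGlue {j : Fin (n + 2)} {g : Fin (n + 2) → C(StdSimplex n, X)}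
    (hg : ∀ l, l ≠ j → ∀ z ∈ stdBoundary n, g l z = x₀) : ContinuousOn (hornGlue j g) (stdHorn j) := by
  rw [stdHorn_eq_iUnion]
  refine LocallyFinite.continuousOn_iUnion (locallyFinite_of_finite _) (fun i => isClosed_range_stdFace i.1)
    fun i => ?_
  have heq : EqOn (hornGlue j g) (g i.1 ∘ faceRetr i.1) (range (stdFace (n := n) i.1)) := by
    rintro _ ⟨z, rfl⟩
    exact hornGlue_eq_of_apply_eq_zero hg i.2 (stdFace_apply_self i.1 z)
  exact (((g i.1).continuous.comp (faceRetr i.1).continuous).continuousOn).congr heq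

/-- **Filling the `j`-th horn**: the continuous map `Δⁿ⁺¹ → X` which on each facet `δᵢ(Δⁿ)`,
`i ≠ j`, is the prescribed `gᵢ` (the `gᵢ` being constant `= x₀` on `∂Δⁿ`, hence compatible), namely
`hornGlue ∘ hornRetr` (Spanier 1981, p. 392: such extensions "exist by the homotopy extension
property"; the Kan condition on the singular complex). [folklore] -/
def hornFill (j : Fin (n + 2)) (g : Fin (n + 2) → C(StdSimplex n, X))
    (hg : ∀ l, l ≠ j → ∀ z ∈ stdBoundary n, g l z = x₀) : C(StdSimplex (n + 1), X) where
  toFun t := hornGlue j g (hornRetr j t)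
  continuous_toFun := (continuousOn_hornGlue hg).comp_continuous (hornRetr j).continuous
    (hornRetr_mem_stdHorn j)

/-- Unfolding of `hornFill`. [folklore] -/
lemma hornFill_apply (j : Fin (n + 2)) (g : Fin (n + 2) → C(StdSimplex n, X))
    (hg : ∀ l, l ≠ j → ∀ z ∈ stdBoundary n, g l z = x₀) (t : StdSimplex (n + 1)) :
    hornFill j g hg t = hornGlue j g (hornRetr j t) := rfl

/-- **The filling has the prescribed faces**: `hornFill j g hg ∘ δᵢ = gᵢ` for `i ≠ j`. [folklore] -/
theorem hornFill_comp_stdFace {j : Fin (n + 2)} (g : Fin (n + 2) → C(StdSimplex n, X))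
    (hg : ∀ l, l ≠ j → ∀ z ∈ stdBoundary n, g l z = x₀) {i : Fin (n + 2)} (hij : i ≠ j) :
    (hornFill j g hg).comp (stdFace i) = g i := by
  ext z
  change hornGlue j g (hornRetr j (stdFace i z)) = g i z
  rw [hornRetr_stdFace hij, hornGlue_eq_of_apply_eq_zero hg hij (stdFace_apply_self i z),
    faceRetr_stdFace]

/-- **The filling is `x₀` wherever two coordinates vanish** (the codimension-two skeleton of
`Δⁿ⁺¹`, which lies in the boundary of every facet): such a point lies on a facet `i ≠ j` and is a
boundary point of it. [folklore] -/
theorem hornFill_apply_of_two_zero {j : Fin (n + 2)} (g : Fin (n + 2) → C(StdSimplex n, X))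
    (hg : ∀ l, l ≠ j → ∀ z ∈ stdBoundary n, g l z = x₀) {t : StdSimplex (n + 1)} {i l : Fin (n + 2)}
    (hil : i ≠ l) (hi : (t : Fin (n + 2) → ℝ) i = 0) (hl : (t : Fin (n + 2) → ℝ) l = 0) :
    hornFill j g hg t = x₀ := by
  -- one of `i`, `l` differs from `j`; call it `a`, the other `b`
  obtain ⟨a, b, hab, haj, ha, hb⟩ : ∃ a b, a ≠ b ∧ a ≠ j ∧ (t : Fin (n + 2) → ℝ) a = 0 ∧
      (t : Fin (n + 2) → ℝ) b = 0 := by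
    by_cases h : i = j
    · exact ⟨l, i, hil.symm, fun e => hil (h.trans e.symm), hl, hi⟩
    · exact ⟨i, l, hil, h, hi, hl⟩
  have ht : t ∈ stdHorn j := ⟨a, haj, ha⟩
  rw [hornFill_apply, hornRetr_eq_self ht, hornGlue_eq_of_apply_eq_zero hg haj ha]
  exact hg a haj _ (faceRetr_mem_stdBoundary hab.symm ha hb)

end Fill

end Literature.AlgebraicTopology.SingularHomology

end
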